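import Summits.BirchSwinnertonDyer.BirchSwinnertonDyer.Theorems.QuadraticBranchSignedControlPlusEtaNonsurjThetaFunctionalEquationLambda
import HarnessLib

/-!
# Route `QuadraticBranchSignedControl` (rung K8, cell `bsd-potss`), residual crux `PlusEtaMainConjectureNonsurj`
# (stmt-BirchSwinnertonDyer-19606): THE FUNCTIONAL EQUATION ON THE QUADRATIC BRANCH, IV — CYCLOTOMIC TOOLS IN `Λ`:
# `Φ_{p^k}(1+T)`, `ω^±_n`, `ω_n` under the Iwasawa involution (self-reciprocity) and modulo `p` (`≡ T^{deg}`)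
# (seat `bsd-potss-k8eta-c2` g27; kernel tool; sequel of `…ThetaFunctionalEquationLambda`)

WHY. To pass the functional equation of `θ_n(η)` (Parts I–II) to the Mazur–Tate LIMITS `M^±` — defined in the tree through the
congruences `θ_{2m}(η) ≡ ±ω⁻_{2m}M⁺ (mod ω_{2m})`, `θ_{2m+1}(η) ≡ ±ω⁺_{2m+1}M⁻ (mod ω_{2m+1})` — one applies `ι` to these congruences,
and needs how the half-products `ω^±_n = ∏ Φ_{p^k}(1+T)` and `ω_n = (1+T)^{pⁿ} − 1` transform: (§10a) each `Φ_{p^{k+1}}(1+T) =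
Σ_{i<p}(1+T)^{ip^k}` is SELF-RECIPROCAL, `(1+T)^{(p−1)p^k}·ι Φ_{p^{k+1}}(1+T) = Φ_{p^{k+1}}(1+T)` (`ι(1+T) = (1+T)⁻¹`, reflect
`i ↦ p−1−i`), hence `(1+T)^d ι(ω^±_n) = ω^±_n`, and `ι(ω_n) = −ω_n·ι(1+T)^{pⁿ}`; (§10b) for the parity lemma of Part III the ideal
`T·ω^±_n·Λ` must have `p`-divisible coefficients below its degree (read here from `ω^±_n ≡ T^{deg} (mod p)`) and `T ω^±_n` is not divisible by `p`
(monic); with the tree's `SmallImageRttOneSided.map_zmod_cyclotomicOmega{Plus,Minus}` (`ω^±_n ≡ T^{deg}`) and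
`PollackPairK.le_natDegree_cyclotomicOmega{Plus,Minus}` (`deg ω⁺_{2m} ≥ m`, `deg ω⁻_{2m+1} ≥ m+1`) the ideals shrink below any degree.

WHAT. §10a `pow_mul_invol_cyclotomic_comp_X_add_one`, `exists_pow_mul_invol_prod_eq`, `exists_pow_mul_invol_cyclotomicOmega{Minus,Plus}`,
`invol_cyclotomicOmega`; §10b `dvd_coeff_coe_X_mul_of_map_zmod_eq`, `not_C_dvd_coe_X_mul_of_monic`.

HONEST FRAMING (cell `bsd-potss`; FULL-BSD rank ≤ 1 programme, HUMAN RULING D-0036/D-0074): TOOL THEOREMS ONLY (cyclotomic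
polynomial algebra) — no definition, no named fact, no `sorry`, axioms standard; nothing about (A), (C1⁺_η), C-cc-1 or `BSD(W,p)` of any
pair is claimed; no stub of 19606 is proved; crux and route OPEN; nothing booked. `--supports stmt-BirchSwinnertonDyer-19606`.

References: [Washington1997] §7.1, §13.2; [Pollack2003] §6.5 (the polynomials `ω_n^±`), Thm. 6.17. Tree: `PlusMinusPAdicLFunction{,Proofs}.lean`
(`cyclotomicOmega{,Plus,Minus}`, `monic_cyclotomic_comp_X_add_one`, `X_mul_cyclotomicOmegaPlus_mul_cyclotomicOmegaMinus`),
`IwasawaAlgebraInvolution.lean`; Mathlib `cyclotomic_prime_pow_eq_geom_sum`.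
-/

set_option autoImplicit false
set_option linter.dupNamespace false
noncomputable section

open scoped Classical

open Polynomial Literature.NumberTheory.EllipticCurves
open Literature.NumberTheory.EllipticCurves.IwasawaAlgebra

namespace Summit.BirchSwinnertonDyer.BirchSwinnertonDyer.Theorems.EtaThetaFunctionalEquation

variable {p : ℕ} [hp : Fact p.Prime]

/-! ## §10 Cyclotomic tools in `Λ`: self-reciprocity of `Φ_{p^k}(1+T)`, `ω^±_n`, `ω_n` under `ι`, and their shape mod `p` -/

/-- **`Φ_{p^{k+1}}(1+T)` is self-reciprocal under `ι`**: `(1+T)^{(p−1)p^k} · ι(Φ_{p^{k+1}}(1+T)) = Φ_{p^{k+1}}(1+T)` in `Λ`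
(`Φ_{p^{k+1}}(Y) = ∑_{i<p} Y^{ip^k}`, `ι(1+T) = (1+T)⁻¹`, reflect `i ↦ p−1−i`). [cite: Washington1997, §13.2] -/
theorem pow_mul_invol_cyclotomic_comp_X_add_one (k : ℕ) :
    (1 + PowerSeries.X : PowerSeries ℤ_[p]) ^ ((p - 1) * p ^ k) *
        invol p ((((cyclotomic (p ^ (k + 1)) ℤ).comp (X + 1)).map (Int.castRingHom ℤ_[p]) : ℤ_[p][X]) :
          PowerSeries ℤ_[p]) =
      ((((cyclotomic (p ^ (k + 1)) ℤ).comp (X + 1)).map (Int.castRingHom ℤ_[p]) : ℤ_[p][X]) : PowerSeries ℤ_[p]) := by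
  have hP : p.Prime := hp.out
  set U : PowerSeries ℤ_[p] := 1 + PowerSeries.X with hU
  set V : PowerSeries ℤ_[p] := 1 + invSubOne p with hV
  have hUV : U * V = 1 := one_add_X_mul_one_add_invSubOne p
  have hcoe : ∀ P : ℤ_[p][X], ((P : ℤ_[p][X]) : PowerSeries ℤ_[p]) = Polynomial.coeToPowerSeries.ringHom P :=
    fun P ↦ rfl
  have hΦ : ((((cyclotomic (p ^ (k + 1)) ℤ).comp (X + 1)).map (Int.castRingHom ℤ_[p]) : ℤ_[p][X]) : PowerSeries ℤ_[p]) =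
      ∑ i ∈ Finset.range p, (U ^ p ^ k) ^ i := by
    rw [cyclotomic_prime_pow_eq_geom_sum hP, Polynomial.sum_comp, Polynomial.map_sum, hcoe, map_sum]
    refine Finset.sum_congr rfl fun i _ ↦ ?_
    rw [Polynomial.pow_comp, Polynomial.pow_comp, Polynomial.X_comp, Polynomial.map_pow, Polynomial.map_pow,
      Polynomial.map_add, Polynomial.map_X, Polynomial.map_one, Polynomial.coeToPowerSeries.ringHom_apply,
      Polynomial.coe_pow, Polynomial.coe_pow, Polynomial.coe_add, Polynomial.coe_X, Polynomial.coe_one, hU, add_comm]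
  rw [hΦ, map_sum, Finset.mul_sum]
  have hιU : invol p U = V := by rw [hU, hV, invol_one_add_X]
  simp_rw [map_pow, hιU]
  rw [← Finset.sum_range_reflect (fun i ↦ (U ^ p ^ k) ^ i) p]
  refine Finset.sum_congr rfl fun i hi ↦ ?_
  have hi' : i < p := Finset.mem_range.mp hi
  have e : (p - 1) * p ^ k = (p - 1 - i) * p ^ k + i * p ^ k := by
    rw [← add_mul]; congr 1; omega
  calc U ^ ((p - 1) * p ^ k) * (V ^ p ^ k) ^ i
      = U ^ ((p - 1 - i) * p ^ k) * (U * V) ^ (i * p ^ k) := by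
        rw [e, pow_add, mul_pow, ← pow_mul, mul_comm (p ^ k) i]; ring
    _ = (U ^ p ^ k) ^ (p - 1 - i) := by rw [hUV, one_pow, mul_one, mul_comm, pow_mul]

omit hp in
/-- Products of self-reciprocal elements are self-reciprocal (the exponents add). [folklore] -/
theorem exists_pow_mul_invol_prod_eq [Fact p.Prime] {ι' : Type*} (s : Finset ι') (P : ι' → PowerSeries ℤ_[p])
    (h : ∀ i ∈ s, ∃ d : ℕ, (1 + PowerSeries.X : PowerSeries ℤ_[p]) ^ d * invol p (P i) = P i) :
    ∃ d : ℕ, (1 + PowerSeries.X : PowerSeries ℤ_[p]) ^ d * invol p (∏ i ∈ s, P i) = ∏ i ∈ s, P i := by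
  induction s using Finset.induction_on with
  | empty => exact ⟨0, by simp⟩
  | insert a s ha ih =>
    obtain ⟨d₁, h₁⟩ := h a (Finset.mem_insert_self a s)
    obtain ⟨d₂, h₂⟩ := ih fun i hi ↦ h i (Finset.mem_insert_of_mem hi)
    refine ⟨d₁ + d₂, ?_⟩
    rw [Finset.prod_insert ha, map_mul, pow_add, mul_mul_mul_comm, h₁, h₂]

/-- **`ω⁻_n` is self-reciprocal under `ι`**: `(1+T)^d · ι(ω⁻_n) = ω⁻_n` for some `d` (`= deg ω⁻_n`). [cite: Washington1997, §13.2] -/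
theorem exists_pow_mul_invol_cyclotomicOmegaMinus (n : ℕ) :
    ∃ d : ℕ, (1 + PowerSeries.X : PowerSeries ℤ_[p]) ^ d *
        invol p (((cyclotomicOmegaMinus p n).map (Int.castRingHom ℤ_[p]) : ℤ_[p][X]) : PowerSeries ℤ_[p]) =
      (((cyclotomicOmegaMinus p n).map (Int.castRingHom ℤ_[p]) : ℤ_[p][X]) : PowerSeries ℤ_[p]) := by
  have hcoe : ∀ P : ℤ_[p][X], ((P : ℤ_[p][X]) : PowerSeries ℤ_[p]) = Polynomial.coeToPowerSeries.ringHom P :=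
    fun P ↦ rfl
  rw [cyclotomicOmegaMinus, Polynomial.map_prod, hcoe, map_prod]
  refine exists_pow_mul_invol_prod_eq _ _ fun k hk ↦ ⟨(p - 1) * p ^ (2 * k - 1 - 1), ?_⟩
  have hk1 : 1 ≤ k := (Finset.mem_Icc.mp hk).1
  have e : 2 * k - 1 = (2 * k - 1 - 1) + 1 := by omega
  rw [e]
  exact pow_mul_invol_cyclotomic_comp_X_add_one _

/-- **`ω⁺_n` is self-reciprocal under `ι`**: `(1+T)^d · ι(ω⁺_n) = ω⁺_n` for some `d`. [cite: Washington1997, §13.2] -/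
theorem exists_pow_mul_invol_cyclotomicOmegaPlus (n : ℕ) :
    ∃ d : ℕ, (1 + PowerSeries.X : PowerSeries ℤ_[p]) ^ d *
        invol p (((cyclotomicOmegaPlus p n).map (Int.castRingHom ℤ_[p]) : ℤ_[p][X]) : PowerSeries ℤ_[p]) =
      (((cyclotomicOmegaPlus p n).map (Int.castRingHom ℤ_[p]) : ℤ_[p][X]) : PowerSeries ℤ_[p]) := by
  have hcoe : ∀ P : ℤ_[p][X], ((P : ℤ_[p][X]) : PowerSeries ℤ_[p]) = Polynomial.coeToPowerSeries.ringHom P :=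
    fun P ↦ rfl
  rw [cyclotomicOmegaPlus, Polynomial.map_prod, hcoe, map_prod]
  refine exists_pow_mul_invol_prod_eq _ _ fun k hk ↦ ⟨(p - 1) * p ^ (2 * k - 1), ?_⟩
  have hk1 : 1 ≤ k := (Finset.mem_Icc.mp hk).1
  have e : 2 * k = (2 * k - 1) + 1 := by omega
  rw [e]
  exact pow_mul_invol_cyclotomic_comp_X_add_one _

/-- **`ι(ω_n) = −ω_n · ι(1+T)^{pⁿ}`** (`ω_n = (1+T)^{pⁿ} − 1`). [cite: Washington1997, §13.2] -/
theorem invol_cyclotomicOmega (n : ℕ) :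
    invol p (((cyclotomicOmega p n).map (Int.castRingHom ℤ_[p]) : ℤ_[p][X]) : PowerSeries ℤ_[p]) =
      -(((cyclotomicOmega p n).map (Int.castRingHom ℤ_[p]) : ℤ_[p][X]) : PowerSeries ℤ_[p]) *
        (1 + invSubOne p) ^ p ^ n := by
  have hUV : (1 + PowerSeries.X : PowerSeries ℤ_[p]) * (1 + invSubOne p) = 1 := one_add_X_mul_one_add_invSubOne p
  have hω : (((cyclotomicOmega p n).map (Int.castRingHom ℤ_[p]) : ℤ_[p][X]) : PowerSeries ℤ_[p]) =
      (1 + PowerSeries.X) ^ p ^ n - 1 := by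
    rw [cyclotomicOmega, Polynomial.map_sub, Polynomial.map_pow, Polynomial.map_add, Polynomial.map_X,
      Polynomial.map_one, Polynomial.coe_sub, Polynomial.coe_pow, Polynomial.coe_add,
      Polynomial.coe_X, Polynomial.coe_one, add_comm]
  rw [hω, map_sub, map_pow, map_one, invol_one_add_X]
  have h1 : ((1 + PowerSeries.X : PowerSeries ℤ_[p]) ^ p ^ n) * (1 + invSubOne p) ^ p ^ n = 1 := by
    rw [← mul_pow, hUV, one_pow]
  linear_combination h1

/-! ### Shape modulo `p` (the tree's `SmallImageRttOneSided.map_zmod_cyclotomicOmega{Plus,Minus}`: `ω^±_n ≡ T^{deg}`), read in `Λ` -/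

/-- Reading `P ≡ X^{deg P} (mod p)` coefficientwise in `Λ`: for `j < deg P`, `p` divides the `j`-th coefficient of the
image of `P` in `Λ = ℤ_p⟦T⟧`, and the `(j+1)`-th coefficient of the image of `T·P` (and its `0`-th one). [folklore] -/
theorem dvd_coeff_coe_X_mul_of_map_zmod_eq {P : ℤ[X]} (hP : P.map (Int.castRingHom (ZMod p)) = X ^ P.natDegree)
    {i : ℕ} (hi : i ≤ P.natDegree) :
    (p : ℤ_[p]) ∣ PowerSeries.coeff i (((X * P).map (Int.castRingHom ℤ_[p]) : ℤ_[p][X]) : PowerSeries ℤ_[p]) := by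
  rw [Polynomial.coeff_coe, Polynomial.coeff_map]
  rcases Nat.eq_zero_or_pos i with rfl | hpos
  · rw [Polynomial.coeff_X_mul_zero, map_zero]; exact dvd_zero _
  · obtain ⟨j, rfl⟩ : ∃ j, i = j + 1 := ⟨i - 1, by omega⟩
    rw [Polynomial.coeff_X_mul, eq_intCast]
    have hj : j < P.natDegree := by omega
    have h := congr_arg (fun Q : (ZMod p)[X] ↦ Q.coeff j) hP
    simp only [Polynomial.coeff_map, eq_intCast, Polynomial.coeff_X_pow, if_neg hj.ne] at h
    obtain ⟨c, hc⟩ := (ZMod.intCast_zmod_eq_zero_iff_dvd _ _).mp h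
    exact ⟨(c : ℤ_[p]), by rw [hc]; push_cast; ring⟩

/-- `T·ω⁺_n` and `T·ω⁻_n` are not divisible by `p` in `Λ` (their top coefficient is `1`). [folklore] -/
theorem not_C_dvd_coe_X_mul_of_monic {P : ℤ[X]} (hP : P.Monic) :
    ¬ PowerSeries.C (p : ℤ_[p]) ∣ (((X * P).map (Int.castRingHom ℤ_[p]) : ℤ_[p][X]) : PowerSeries ℤ_[p]) := by
  rintro ⟨E, hE⟩
  have h1 := congr_arg (PowerSeries.coeff (X * P).natDegree) hE
  rw [Polynomial.coeff_coe, Polynomial.coeff_map, Polynomial.coeff_natDegree, (monic_X.mul hP).leadingCoeff,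
    map_one, PowerSeries.coeff_C_mul] at h1
  exact (PadicInt.irreducible_p (p := p)).not_isUnit (isUnit_of_dvd_one ⟨_, h1⟩)

end Summit.BirchSwinnertonDyer.BirchSwinnertonDyer.Theorems.EtaThetaFunctionalEquation

end
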